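import Mathlib
import HarnessLib
import Summits.ResolutionOfSingularities.ResolutionOfSingularities.Theorems.WildQuotientsWildQuotientResolutionS1aA1Move1
import Summits.ResolutionOfSingularities.ResolutionOfSingularities.Theorems.WildQuotientsWildQuotientResolutionS1aA1Move2Model
import Summits.ResolutionOfSingularities.ResolutionOfSingularities.Theorems.WildQuotientsWildQuotientResolutionS1aA1Move2Regular
import Summits.ResolutionOfSingularities.ResolutionOfSingularities.Theorems.WildQuotientsWildQuotientResolutionS1aA1Move2Cover
import Summits.ResolutionOfSingularities.ResolutionOfSingularities.Theorems.WildQuotientsWildQuotientResolutionS1aA1Move2ModelRows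
import Summits.ResolutionOfSingularities.ResolutionOfSingularities.Theorems.WildQuotientsWildQuotientResolutionS1aChartTransition
import Summits.ResolutionOfSingularities.ResolutionOfSingularities.Theorems.WildQuotientsWildQuotientResolutionS1aModelNodeCentre
import Summits.ResolutionOfSingularities.ResolutionOfSingularities.Theorems.WildQuotientsWildQuotientResolutionS1aModelNodeAtlas
import Summits.ResolutionOfSingularities.ResolutionOfSingularities.Theorems.WildQuotientsWildQuotientResolutionS1aKillGlue

/-!
# S1a — INSTANCE I-2 (a1): PINS for the free model `k[x_none, x′][1/h]` of a producer chart's node, E-free section pins, and the move-2 cover product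

[OURS · L1 W4.5c · lead-1 g12; plan-1 R-F15c (I-2 := MT-a1″); tools for the assembly of moves 2/3 via ✓`exists_isAdmissibleCentre_of_modelNode` /
✓`exists_moveAtlas_of_node`] — NOT statements of the manuscript; counted 0; AI-level work, weaker than expert review. Crux stmt-ResolutionOfSingularities-17941
`CyclicQuotientFourfolds`, line `s1a-logminvertex` v13.

* generic (any node `(B, 𝒜)`, centre `(f, w)`, chart element `b`, model `Ψ : R^w ≃ P`): `chartRingEquivAway_invSelf` (the model iso on `(bT^d)⁻¹`),
  `algebraMap_mem_mapGrading_chartNode` / `invSelf_mem_mapGrading_chartNode` (degrees in the transported grading), `consIndexEquiv_int_zero` / `consIndexEquiv_nat_zero`,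
  `symm_mul_appLE_eq_of_pin` (a section `E⁻¹ z` is pinned E-FREELY by `E⁻¹ z · π^* x₁ = π^* x₀` as soon as `z · T(e' x₁) = T(e' x₀)` in the chart ring);
* a1 (`e : A ≃ k[x₀..x₃]`, centre `(e⁻¹x₀, e⁻¹x₁)`, weights `(2,1)`): degrees of `X₀′, X₁′, x_none, h⁻¹` relative to `θ = consIndexEquiv r (1,0)` (`a1_model_degree_*'`),
  `chartRingEquivAway_residualSection` (model value `X₀′ⁿ h⁻¹` of `X₁ⁿ/(yT^{dbar})`), `a1_section_pin` (`(X₁^{dp}/(y₁T^{dbar})) · y₁ = y₀` in the chart ring, `y₀ = x₀^{dp}`),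
  `a1m2_coverElement_one_eq` (the move-2 cover element `N₂^{2dd₂}T^{dbar₂}` is the `2dd₂`-th power of `∏_j (Y₂ + j s²·s₂Y₀)`).
-/

set_option linter.dupNamespace false

noncomputable section

open CategoryTheory Limits AlgebraicGeometry TopologicalSpace Topology Opposite MvPolynomial
open Literature.AlgebraicGeometry.Resolution Literature.AlgebraicGeometry.RelativeSpec
open scoped LaurentPolynomial
open Summit.ResolutionOfSingularities.ResolutionOfSingularities.Theorems.WildQuotientResolution.S1
open Summit.ResolutionOfSingularities.ResolutionOfSingularities.Theorems.WildQuotientResolution.S1.NodeAtlas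
open Summit.ResolutionOfSingularities.ResolutionOfSingularities.Theorems.WildQuotientResolution.S1.CoarseChart
open Summit.ResolutionOfSingularities.ResolutionOfSingularities.Theorems.WildQuotientResolution.S1.ProducerStep
open Summit.ResolutionOfSingularities.ResolutionOfSingularities.Theorems.WildQuotientResolution.S1.NpFrame
open Summit.ResolutionOfSingularities.ResolutionOfSingularities.Theorems.WildQuotientResolution.S1.GoodCharts
open Summit.ResolutionOfSingularities.ResolutionOfSingularities.Theorems.WildQuotientResolution.S1.BlowupCharts
open Summit.ResolutionOfSingularities.ResolutionOfSingularities.Theorems.WildQuotientResolution.S1.KillableTransport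
open Summit.ResolutionOfSingularities.ResolutionOfSingularities.Theorems.WildQuotientResolution.S1.KillCert
open Summit.ResolutionOfSingularities.ResolutionOfSingularities.Theorems.WildQuotientResolution.S1.ReesBigrading
open Summit.ResolutionOfSingularities.ResolutionOfSingularities.Theorems.WildQuotientResolution.S1.NodeTransport
open Summit.ResolutionOfSingularities.ResolutionOfSingularities.Theorems.WildQuotientResolution.S1.CobordantTransport
open Summit.ResolutionOfSingularities.ResolutionOfSingularities.Theorems.WildQuotientResolution.BlowupExit
open Summit.ResolutionOfSingularities.ResolutionOfSingularities.Theorems.WildQuotientResolution.S1.KillGlue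

/-! ## Generic pins for free models of producer chart rings -/

namespace Summit.ResolutionOfSingularities.ResolutionOfSingularities.Theorems.WildQuotientResolution.S1.CobordantTransport

universe u

section Generic

variable {m : ℕ} (r : Fin m → ℕ) {B : Type u} [CommRing B] (𝒜 : (Π j : Fin m, ZMod (r j)) → AddSubgroup B) [GradedRing 𝒜] {c : ℕ}
  (f : Fin c → B) {δ : Fin c → Π j : Fin m, ZMod (r j)} (w : Fin c → ℕ) (hf : ∀ i, f i ∈ 𝒜 (δ i))
  (d : ℕ) (b : ↥(𝒜 0)) (hb : b ∈ (traceFiltration 𝒜 f w).ideal d) {P : Type u} [CommRing P] (Ψ : ↥(cobordantAlgebra f w) ≃+* P)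

/-- Pin: the model isomorphism sends the inverted cover element to the inverted image. -/
theorem chartRingEquivAway_invSelf :
    chartRingEquivAway 𝒜 f w d b hb Ψ (IsLocalization.Away.invSelf (coverElement 𝒜 f w d b hb)) = IsLocalization.Away.invSelf (Ψ (coverElement 𝒜 f w d b hb)) := by
  have h1 : algebraMap P (Localization.Away (Ψ (coverElement 𝒜 f w d b hb))) (Ψ (coverElement 𝒜 f w d b hb)) *
      chartRingEquivAway 𝒜 f w d b hb Ψ (IsLocalization.Away.invSelf (coverElement 𝒜 f w d b hb)) = 1 := by
    rw [← chartRingEquivAway_algebraMap, ← map_mul, IsLocalization.Away.mul_invSelf, map_one]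
  have h2 := IsLocalization.Away.mul_invSelf (S := Localization.Away (Ψ (coverElement 𝒜 f w d b hb))) (Ψ (coverElement 𝒜 f w d b hb))
  calc chartRingEquivAway 𝒜 f w d b hb Ψ (IsLocalization.Away.invSelf (coverElement 𝒜 f w d b hb))
      = (algebraMap P (Localization.Away (Ψ (coverElement 𝒜 f w d b hb))) (Ψ (coverElement 𝒜 f w d b hb)) *
          IsLocalization.Away.invSelf (Ψ (coverElement 𝒜 f w d b hb))) *
        chartRingEquivAway 𝒜 f w d b hb Ψ (IsLocalization.Away.invSelf (coverElement 𝒜 f w d b hb)) := by rw [h2, one_mul]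
    _ = (algebraMap P (Localization.Away (Ψ (coverElement 𝒜 f w d b hb))) (Ψ (coverElement 𝒜 f w d b hb)) *
          chartRingEquivAway 𝒜 f w d b hb Ψ (IsLocalization.Away.invSelf (coverElement 𝒜 f w d b hb))) *
        IsLocalization.Away.invSelf (Ψ (coverElement 𝒜 f w d b hb)) := by ring
    _ = IsLocalization.Away.invSelf (Ψ (coverElement 𝒜 f w d b hb)) := by rw [h1, one_mul]

/-- Degrees in the free model: `Ψ z` has degree `consIndexEquiv r e` for `z ∈ R^w` of bidegree `e`. -/
theorem algebraMap_mem_mapGrading_chartNode {e : ℤ × (Π j : Fin m, ZMod (r j))} {z : ↥(cobordantAlgebra f w)} (hz : z ∈ reesPiece 𝒜 f w e) :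
    letI := chartNodeGradedRing r 𝒜 f w hf d b hb
    algebraMap P (Localization.Away (Ψ (coverElement 𝒜 f w d b hb))) (Ψ z) ∈
      mapGrading (chartNodeGrading r 𝒜 f w hf d b hb) (chartRingEquivAway 𝒜 f w d b hb Ψ) (consIndexEquiv r e) := by
  letI := chartNodeGradedRing r 𝒜 f w hf d b hb
  rw [← chartRingEquivAway_algebraMap, map_mem_mapGrading_iff]
  change _ ∈ chartGrading 𝒜 f w hf d b hb ((consIndexEquiv r).symm (consIndexEquiv r e))
  rw [AddEquiv.symm_apply_apply]
  exact algebraMap_mem_chartGrading 𝒜 f w hf d b hb hz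

/-- Degrees in the free model: the inverted cover element has degree `consIndexEquiv r (-d, 0)`. -/
theorem invSelf_mem_mapGrading_chartNode :
    letI := chartNodeGradedRing r 𝒜 f w hf d b hb
    IsLocalization.Away.invSelf (Ψ (coverElement 𝒜 f w d b hb)) ∈
      mapGrading (chartNodeGrading r 𝒜 f w hf d b hb) (chartRingEquivAway 𝒜 f w d b hb Ψ) (consIndexEquiv r (-(d : ℤ), 0)) := by
  letI := chartNodeGradedRing r 𝒜 f w hf d b hb
  rw [← chartRingEquivAway_invSelf, map_mem_mapGrading_iff]
  change _ ∈ chartGrading 𝒜 f w hf d b hb ((consIndexEquiv r).symm (consIndexEquiv r (-(d : ℤ), 0)))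
  rw [AddEquiv.symm_apply_apply]
  exact invSelf_mem_chartGrading 𝒜 f w hf d b hb

omit [GradedRing 𝒜] in
/-- `consIndexEquiv r (n, 0) = n • consIndexEquiv r (1, 0)`. -/
theorem consIndexEquiv_int_zero (n : ℤ) : consIndexEquiv r (n, (0 : Π j : Fin m, ZMod (r j))) = n • consIndexEquiv r ((1 : ℤ), 0) := by
  rw [← map_zsmul]
  congr 1
  ext <;> simp

omit [GradedRing 𝒜] in
/-- `consIndexEquiv r (n, 0) = n • consIndexEquiv r (1, 0)` for `n : ℕ`. -/
theorem consIndexEquiv_nat_zero (n : ℕ) : consIndexEquiv r ((n : ℤ), (0 : Π j : Fin m, ZMod (r j))) = n • consIndexEquiv r ((1 : ℤ), 0) := by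
  rw [← map_nsmul]
  congr 1
  ext <;> simp


/-- **E-free pins from the node's pin**: if `E` reads pulled-back sections through `T ∘ e'` (`hpin`) and `z · T w₁ = T w₀` in the chart ring, then the
section `E⁻¹ z` satisfies `E⁻¹ z · π^* x₁ = π^* x₀` (`e' xᵢ = wᵢ`). [OURS · L1 W4.5c] -/
theorem symm_mul_appLE_eq_of_pin {V' V : Scheme.{u}} (π : V' ⟶ V) (O : V.Opens) (O' : V'.Opens) (hle : O' ≤ π ⁻¹ᵁ O)
    {ι : Type} [AddCommGroup ι] [DecidableEq ι] {R : Type u} [CommRing R] (𝒢 : ι → AddSubgroup R) [GradedRing 𝒢]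
    (E : Γ(V', O') ≃+* ↥(𝒢 0)) {B₀ : Type u} [CommRing B₀] (e' : Γ(V, O) ≃+* B₀) (T : B₀ →+* R)
    (hpin : ∀ x : Γ(V, O), ((E (π.appLE O O' hle x) : ↥(𝒢 0)) : R) = T (e' x))
    (z : ↥(𝒢 0)) (x₀ x₁ : Γ(V, O)) (w₀ w₁ : B₀) (hx₀ : e' x₀ = w₀) (hx₁ : e' x₁ = w₁) (h : (z : R) * T w₁ = T w₀) :
    E.symm z * π.appLE O O' hle x₁ = π.appLE O O' hle x₀ := by
  apply E.injective
  apply Subtype.ext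
  rw [map_mul]
  refine (SetLike.GradeZero.coe_mul _ _).trans ?_
  rw [E.apply_symm_apply, hpin, hpin, hx₀, hx₁]
  exact h


end Generic

/-! ### Degrees of the generators of the free model `k[x_none, x′][1/h]` of an a1 producer chart, relative to `θ = consIndexEquiv r (1, 0)` -/

section A1Degrees

variable {k : Type} [Field k] {A : Type} [CommRing A] (e : A ≃+* MvPolynomial (Fin 4) k)
  {m : ℕ} (r : Fin m → ℕ) (𝒜 : (Π j : Fin m, ZMod (r j)) → AddSubgroup A) [GradedRing 𝒜]
  (hf : ∀ i, (⇑e.symm ∘ ![X 0, X 1] : Fin 2 → A) i ∈ 𝒜 ((fun _ => (0 : Π j : Fin m, ZMod (r j))) i))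
  {dbar : ℕ} (y : ↥(𝒜 0)) (hy : y ∈ (traceFiltration 𝒜 (⇑e.symm ∘ ![X 0, X 1] : Fin 2 → A) ![2, 1]).ideal dbar)

include hf in
/-- `X₀′` has degree `2 • θ`. -/
theorem a1_model_degree_X_some_zero' :
    letI := chartNodeGradedRing r 𝒜 (⇑e.symm ∘ ![X 0, X 1] : Fin 2 → A) ![2, 1] hf dbar y hy
    algebraMap (MvPolynomial (Option (Fin 4)) k) (Localization.Away (A1.a1ModelEquiv e (coverElement 𝒜 (⇑e.symm ∘ ![X 0, X 1] : Fin 2 → A) ![2, 1] dbar y hy))) (X (some 0)) ∈ mapGrading (chartNodeGrading r 𝒜 (⇑e.symm ∘ ![X 0, X 1] : Fin 2 → A) ![2, 1] hf dbar y hy) (chartRingEquivAway 𝒜 (⇑e.symm ∘ ![X 0, X 1] : Fin 2 → A) ![2, 1] dbar y hy (A1.a1ModelEquiv e)) (2 • (consIndexEquiv r ((1 : ℤ), (0 : Π j : Fin m, ZMod (r j))))) := by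
  letI := chartNodeGradedRing r 𝒜 (⇑e.symm ∘ ![X 0, X 1] : Fin 2 → A) ![2, 1] hf dbar y hy
  have h := algebraMap_mem_mapGrading_chartNode r 𝒜 (⇑e.symm ∘ ![X 0, X 1] : Fin 2 → A) ![2, 1] hf dbar y hy (A1.a1ModelEquiv e) (u'_mem_reesPiece 𝒜 (⇑e.symm ∘ ![X 0, X 1] : Fin 2 → A) (δ := fun _ => 0) ![2, 1] hf 0)
  rw [A1.a1ModelEquiv_u'_zero] at h
  have hidx : consIndexEquiv r ((((![2, 1] : Fin 2 → ℕ) 0 : ℕ) : ℤ), (fun _ : Fin 2 => (0 : Π j : Fin m, ZMod (r j))) 0) = 2 • (consIndexEquiv r ((1 : ℤ), (0 : Π j : Fin m, ZMod (r j)))) := by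
    change consIndexEquiv r (((2 : ℕ) : ℤ), (0 : Π j : Fin m, ZMod (r j))) = _
    exact consIndexEquiv_nat_zero r 2
  rw [hidx] at h
  exact h

include hf in
/-- `X₁′` has degree `θ`. -/
theorem a1_model_degree_X_some_one' :
    letI := chartNodeGradedRing r 𝒜 (⇑e.symm ∘ ![X 0, X 1] : Fin 2 → A) ![2, 1] hf dbar y hy
    algebraMap (MvPolynomial (Option (Fin 4)) k) (Localization.Away (A1.a1ModelEquiv e (coverElement 𝒜 (⇑e.symm ∘ ![X 0, X 1] : Fin 2 → A) ![2, 1] dbar y hy))) (X (some 1)) ∈ mapGrading (chartNodeGrading r 𝒜 (⇑e.symm ∘ ![X 0, X 1] : Fin 2 → A) ![2, 1] hf dbar y hy) (chartRingEquivAway 𝒜 (⇑e.symm ∘ ![X 0, X 1] : Fin 2 → A) ![2, 1] dbar y hy (A1.a1ModelEquiv e)) (consIndexEquiv r ((1 : ℤ), (0 : Π j : Fin m, ZMod (r j)))) := by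
  letI := chartNodeGradedRing r 𝒜 (⇑e.symm ∘ ![X 0, X 1] : Fin 2 → A) ![2, 1] hf dbar y hy
  have h := algebraMap_mem_mapGrading_chartNode r 𝒜 (⇑e.symm ∘ ![X 0, X 1] : Fin 2 → A) ![2, 1] hf dbar y hy (A1.a1ModelEquiv e) (u'_mem_reesPiece 𝒜 (⇑e.symm ∘ ![X 0, X 1] : Fin 2 → A) (δ := fun _ => 0) ![2, 1] hf 1)
  rw [A1.a1ModelEquiv_u'_one] at h
  have hidx : consIndexEquiv r ((((![2, 1] : Fin 2 → ℕ) 1 : ℕ) : ℤ), (fun _ : Fin 2 => (0 : Π j : Fin m, ZMod (r j))) 1) = (consIndexEquiv r ((1 : ℤ), (0 : Π j : Fin m, ZMod (r j)))) := by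
    change consIndexEquiv r (((1 : ℕ) : ℤ), (0 : Π j : Fin m, ZMod (r j))) = _
    rw [Nat.cast_one]
  rw [hidx] at h
  exact h

include hf in
/-- `x_none = s` has degree `-θ`. -/
theorem a1_model_degree_X_none' :
    letI := chartNodeGradedRing r 𝒜 (⇑e.symm ∘ ![X 0, X 1] : Fin 2 → A) ![2, 1] hf dbar y hy
    algebraMap (MvPolynomial (Option (Fin 4)) k) (Localization.Away (A1.a1ModelEquiv e (coverElement 𝒜 (⇑e.symm ∘ ![X 0, X 1] : Fin 2 → A) ![2, 1] dbar y hy))) (X none) ∈ mapGrading (chartNodeGrading r 𝒜 (⇑e.symm ∘ ![X 0, X 1] : Fin 2 → A) ![2, 1] hf dbar y hy) (chartRingEquivAway 𝒜 (⇑e.symm ∘ ![X 0, X 1] : Fin 2 → A) ![2, 1] dbar y hy (A1.a1ModelEquiv e)) (-(consIndexEquiv r ((1 : ℤ), (0 : Π j : Fin m, ZMod (r j))))) := by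
  letI := chartNodeGradedRing r 𝒜 (⇑e.symm ∘ ![X 0, X 1] : Fin 2 → A) ![2, 1] hf dbar y hy
  have h := algebraMap_mem_mapGrading_chartNode r 𝒜 (⇑e.symm ∘ ![X 0, X 1] : Fin 2 → A) ![2, 1] hf dbar y hy (A1.a1ModelEquiv e) (s_mem_reesPiece 𝒜 (⇑e.symm ∘ ![X 0, X 1] : Fin 2 → A) ![2, 1])
  rw [A1.a1ModelEquiv_s] at h
  have hidx : consIndexEquiv r ((-1 : ℤ), (0 : Π j : Fin m, ZMod (r j))) = -(consIndexEquiv r ((1 : ℤ), (0 : Π j : Fin m, ZMod (r j)))) := by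
    rw [consIndexEquiv_int_zero r (-1), neg_one_zsmul]
  rw [hidx] at h
  exact h

include hf in
/-- `h⁻¹` has degree `-(dbar • θ)`. -/
theorem a1_model_degree_invSelf' :
    letI := chartNodeGradedRing r 𝒜 (⇑e.symm ∘ ![X 0, X 1] : Fin 2 → A) ![2, 1] hf dbar y hy
    IsLocalization.Away.invSelf (A1.a1ModelEquiv e (coverElement 𝒜 (⇑e.symm ∘ ![X 0, X 1] : Fin 2 → A) ![2, 1] dbar y hy)) ∈ mapGrading (chartNodeGrading r 𝒜 (⇑e.symm ∘ ![X 0, X 1] : Fin 2 → A) ![2, 1] hf dbar y hy) (chartRingEquivAway 𝒜 (⇑e.symm ∘ ![X 0, X 1] : Fin 2 → A) ![2, 1] dbar y hy (A1.a1ModelEquiv e)) (-(dbar • (consIndexEquiv r ((1 : ℤ), (0 : Π j : Fin m, ZMod (r j)))))) := by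
  letI := chartNodeGradedRing r 𝒜 (⇑e.symm ∘ ![X 0, X 1] : Fin 2 → A) ![2, 1] hf dbar y hy
  have h := invSelf_mem_mapGrading_chartNode r 𝒜 (⇑e.symm ∘ ![X 0, X 1] : Fin 2 → A) ![2, 1] hf dbar y hy (A1.a1ModelEquiv e)
  have hidx : consIndexEquiv r (-(dbar : ℤ), (0 : Π j : Fin m, ZMod (r j))) = -(dbar • (consIndexEquiv r ((1 : ℤ), (0 : Π j : Fin m, ZMod (r j))))) := by
    rw [consIndexEquiv_int_zero r, neg_zsmul, natCast_zsmul]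
  rw [hidx] at h
  exact h

include hf in
/-- Pin: the model value of the residual section `X₁^{n}/(yT^{dbar})` is `X₀′^{n} · h⁻¹`. -/
theorem chartRingEquivAway_residualSection (n : ℕ) :
    (chartRingEquivAway 𝒜 (⇑e.symm ∘ ![X 0, X 1] : Fin 2 → A) ![2, 1] dbar y hy (A1.a1ModelEquiv e)) (algebraMap _ (ChartRing 𝒜 (⇑e.symm ∘ ![X 0, X 1] : Fin 2 → A) ![2, 1] dbar y hy) (cobordantAlgebra.u' (⇑e.symm ∘ ![X 0, X 1] : Fin 2 → A) ![2, 1] 0 ^ n) *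
        IsLocalization.Away.invSelf (coverElement 𝒜 (⇑e.symm ∘ ![X 0, X 1] : Fin 2 → A) ![2, 1] dbar y hy)) =
      algebraMap (MvPolynomial (Option (Fin 4)) k) (Localization.Away (A1.a1ModelEquiv e (coverElement 𝒜 (⇑e.symm ∘ ![X 0, X 1] : Fin 2 → A) ![2, 1] dbar y hy))) (X (some 0)) ^ n * IsLocalization.Away.invSelf (A1.a1ModelEquiv e (coverElement 𝒜 (⇑e.symm ∘ ![X 0, X 1] : Fin 2 → A) ![2, 1] dbar y hy)) := by
  have _ := hf
  rw [map_mul, chartRingEquivAway_algebraMap, map_pow, A1.a1ModelEquiv_u'_zero, map_pow, chartRingEquivAway_invSelf]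

omit [GradedRing 𝒜] in
/-- **The pin of the residual section `z₀′ = x₀^{dp}T^{dbar}/(y₁T^{dbar})` of the norm chart**: `z₀′ · y₁ = y₀` in the chart ring (`y₀ = x₀^{dp}`). -/
theorem a1_section_pin [GradedRing 𝒜] {p : ℕ} (d : ℕ) (y₀ y₁ : ↥(𝒜 0)) (hy₁ : y₁ ∈ (traceFiltration 𝒜 (⇑e.symm ∘ ![X 0, X 1] : Fin 2 → A) ![2, 1]).ideal (d * (2 * p)))
    (hy₀val : (y₀ : A) = e.symm (X 0) ^ (d * p)) :
    (algebraMap _ (ChartRing 𝒜 (⇑e.symm ∘ ![X 0, X 1] : Fin 2 → A) ![2, 1] (d * (2 * p)) y₁ hy₁) (cobordantAlgebra.u' (⇑e.symm ∘ ![X 0, X 1] : Fin 2 → A) ![2, 1] 0 ^ (d * p)) * IsLocalization.Away.invSelf (coverElement 𝒜 (⇑e.symm ∘ ![X 0, X 1] : Fin 2 → A) ![2, 1] (d * (2 * p)) y₁ hy₁)) *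
        toChartRing 𝒜 (⇑e.symm ∘ ![X 0, X 1] : Fin 2 → A) ![2, 1] (d * (2 * p)) y₁ hy₁ y₁ = toChartRing 𝒜 (⇑e.symm ∘ ![X 0, X 1] : Fin 2 → A) ![2, 1] (d * (2 * p)) y₁ hy₁ y₀ := by
  have hRw : cobordantAlgebra.u' (⇑e.symm ∘ ![X 0, X 1] : Fin 2 → A) ![2, 1] 0 ^ (d * p) * algebraMap A ↥(cobordantAlgebra (⇑e.symm ∘ ![X 0, X 1] : Fin 2 → A) ![2, 1]) (y₁ : A) =
      algebraMap A ↥(cobordantAlgebra (⇑e.symm ∘ ![X 0, X 1] : Fin 2 → A) ![2, 1]) (y₀ : A) * (coverElement 𝒜 (⇑e.symm ∘ ![X 0, X 1] : Fin 2 → A) ![2, 1] (d * (2 * p)) y₁ hy₁) := by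
    refine Subtype.ext ?_
    rw [MulMemClass.coe_mul, MulMemClass.coe_mul, SubmonoidClass.coe_pow, cobordantAlgebra.coe_u', cobordantAlgebra.coe_algebraMap,
      cobordantAlgebra.coe_algebraMap, coe_coverElement, hy₀val]
    change (LaurentPolynomial.C (e.symm (X 0)) * LaurentPolynomial.T ((2 : ℕ) : ℤ)) ^ (d * p) * LaurentPolynomial.C (y₁ : A) =
      LaurentPolynomial.C (e.symm (X 0) ^ (d * p)) * (LaurentPolynomial.C (y₁ : A) * LaurentPolynomial.T (((d * (2 * p) : ℕ)) : ℤ))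
    rw [mul_pow, ← map_pow, LaurentPolynomial.T_pow, show ((d * p : ℕ) : ℤ) * ((2 : ℕ) : ℤ) = ((d * (2 * p) : ℕ) : ℤ) by push_cast; ring]
    ring
  change (algebraMap _ (ChartRing 𝒜 (⇑e.symm ∘ ![X 0, X 1] : Fin 2 → A) ![2, 1] (d * (2 * p)) y₁ hy₁) (cobordantAlgebra.u' (⇑e.symm ∘ ![X 0, X 1] : Fin 2 → A) ![2, 1] 0 ^ (d * p)) * IsLocalization.Away.invSelf (coverElement 𝒜 (⇑e.symm ∘ ![X 0, X 1] : Fin 2 → A) ![2, 1] (d * (2 * p)) y₁ hy₁)) *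
      algebraMap _ (ChartRing 𝒜 (⇑e.symm ∘ ![X 0, X 1] : Fin 2 → A) ![2, 1] (d * (2 * p)) y₁ hy₁) (algebraMap A ↥(cobordantAlgebra (⇑e.symm ∘ ![X 0, X 1] : Fin 2 → A) ![2, 1]) (y₁ : A)) = algebraMap _ (ChartRing 𝒜 (⇑e.symm ∘ ![X 0, X 1] : Fin 2 → A) ![2, 1] (d * (2 * p)) y₁ hy₁) (algebraMap A ↥(cobordantAlgebra (⇑e.symm ∘ ![X 0, X 1] : Fin 2 → A) ![2, 1]) (y₀ : A))
  calc (algebraMap _ (ChartRing 𝒜 (⇑e.symm ∘ ![X 0, X 1] : Fin 2 → A) ![2, 1] (d * (2 * p)) y₁ hy₁) (cobordantAlgebra.u' (⇑e.symm ∘ ![X 0, X 1] : Fin 2 → A) ![2, 1] 0 ^ (d * p)) * IsLocalization.Away.invSelf (coverElement 𝒜 (⇑e.symm ∘ ![X 0, X 1] : Fin 2 → A) ![2, 1] (d * (2 * p)) y₁ hy₁)) *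
        algebraMap _ (ChartRing 𝒜 (⇑e.symm ∘ ![X 0, X 1] : Fin 2 → A) ![2, 1] (d * (2 * p)) y₁ hy₁) (algebraMap A ↥(cobordantAlgebra (⇑e.symm ∘ ![X 0, X 1] : Fin 2 → A) ![2, 1]) (y₁ : A))
      = algebraMap _ (ChartRing 𝒜 (⇑e.symm ∘ ![X 0, X 1] : Fin 2 → A) ![2, 1] (d * (2 * p)) y₁ hy₁) (cobordantAlgebra.u' (⇑e.symm ∘ ![X 0, X 1] : Fin 2 → A) ![2, 1] 0 ^ (d * p) * algebraMap A ↥(cobordantAlgebra (⇑e.symm ∘ ![X 0, X 1] : Fin 2 → A) ![2, 1]) (y₁ : A)) *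
        IsLocalization.Away.invSelf (coverElement 𝒜 (⇑e.symm ∘ ![X 0, X 1] : Fin 2 → A) ![2, 1] (d * (2 * p)) y₁ hy₁) := by rw [map_mul]; ring
    _ = algebraMap _ (ChartRing 𝒜 (⇑e.symm ∘ ![X 0, X 1] : Fin 2 → A) ![2, 1] (d * (2 * p)) y₁ hy₁) (algebraMap A ↥(cobordantAlgebra (⇑e.symm ∘ ![X 0, X 1] : Fin 2 → A) ![2, 1]) (y₀ : A)) * (algebraMap _ (ChartRing 𝒜 (⇑e.symm ∘ ![X 0, X 1] : Fin 2 → A) ![2, 1] (d * (2 * p)) y₁ hy₁) (coverElement 𝒜 (⇑e.symm ∘ ![X 0, X 1] : Fin 2 → A) ![2, 1] (d * (2 * p)) y₁ hy₁) * IsLocalization.Away.invSelf (coverElement 𝒜 (⇑e.symm ∘ ![X 0, X 1] : Fin 2 → A) ![2, 1] (d * (2 * p)) y₁ hy₁)) := by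
        rw [hRw, map_mul]; ring
    _ = algebraMap _ (ChartRing 𝒜 (⇑e.symm ∘ ![X 0, X 1] : Fin 2 → A) ![2, 1] (d * (2 * p)) y₁ hy₁) (algebraMap A ↥(cobordantAlgebra (⇑e.symm ∘ ![X 0, X 1] : Fin 2 → A) ![2, 1]) (y₀ : A)) := by rw [IsLocalization.Away.mul_invSelf, mul_one]


end A1Degrees

end Summit.ResolutionOfSingularities.ResolutionOfSingularities.Theorems.WildQuotientResolution.S1.CobordantTransport

/-! ### The second cover element of move 2 is the `2dd₂`-th power of the product of the translates of the plain `x₂T`-chart -/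

namespace Summit.ResolutionOfSingularities.ResolutionOfSingularities.Theorems.WildQuotientResolution.S1.KillCert.A1

/-- `c₁ = (∏_j (Y₂ + j s²·(s₂ Y₀)))^{2dd₂}` for the move-2 cover element `c₁ = N₂^{2dd₂} T^{dbar₂}`. -/
theorem a1m2_coverElement_one_eq {P : Type} [CommRing P] (s X₀ x₂ : P) {p : ℕ} [NeZero p] (d d₂ : ℕ) (c₁ : ↥(cobordantAlgebra (![X₀, x₂] : Fin 2 → P) ![2, 1]))
    (hc₁ : (c₁ : P[T;T⁻¹]) = LaurentPolynomial.C ((∏ i : ZMod p, (x₂ + (i.val : P) * (s ^ 2 * X₀))) ^ (2 * d * d₂)) *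
      LaurentPolynomial.T ((d₂ * (d * (2 * p)) : ℕ) : ℤ)) :
    c₁ = (∏ j : ZMod p, (cobordantAlgebra.u' (![X₀, x₂] : Fin 2 → P) ![2, 1] 1 + algebraMap P _ ((j.val : P) * s ^ 2) *
      (cobordantAlgebra.s (![X₀, x₂] : Fin 2 → P) ![2, 1] * cobordantAlgebra.u' (![X₀, x₂] : Fin 2 → P) ![2, 1] 0))) ^ (2 * d * d₂) := by
  refine Subtype.ext ?_
  rw [SubmonoidClass.coe_pow, SubmonoidClass.coe_finsetProd, hc₁]
  have hj : ∀ j : ZMod p, ((cobordantAlgebra.u' (![X₀, x₂] : Fin 2 → P) ![2, 1] 1 + algebraMap P _ ((j.val : P) * s ^ 2) *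
      (cobordantAlgebra.s (![X₀, x₂] : Fin 2 → P) ![2, 1] * cobordantAlgebra.u' (![X₀, x₂] : Fin 2 → P) ![2, 1] 0) :
        ↥(cobordantAlgebra (![X₀, x₂] : Fin 2 → P) ![2, 1])) : P[T;T⁻¹]) =
      LaurentPolynomial.C x₂ * LaurentPolynomial.T 1 +
        (j.val : P[T;T⁻¹]) * (LaurentPolynomial.C (s ^ 2) * (LaurentPolynomial.T (-1) * (LaurentPolynomial.C X₀ * LaurentPolynomial.T 2))) := by
    intro j
    rw [AddMemClass.coe_add, MulMemClass.coe_mul, MulMemClass.coe_mul, cobordantAlgebra.coe_u', cobordantAlgebra.coe_u', cobordantAlgebra.coe_s,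
      cobordantAlgebra.coe_algebraMap, map_mul, map_natCast]
    simp only [Matrix.cons_val_zero, Matrix.cons_val_one]
    push_cast
    ring
  simp_rw [hj]
  rw [← a1m2_norm_T s X₀ x₂ (p := p), mul_pow, ← map_pow, LaurentPolynomial.T_pow]
  congr 2
  push_cast
  ring

end Summit.ResolutionOfSingularities.ResolutionOfSingularities.Theorems.WildQuotientResolution.S1.KillCert.A1

end
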